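import Literature.MathematicalPhysics.QuantumFieldTheory.Balaban1983to89.BlockAveragingHaarAC
import Literature.MathematicalPhysics.QuantumFieldTheory.Balaban1983to89.B14Eq12InteriorLocality
import HarnessLib

/-!
# Route `FluctuationComparisonRegPrIntL` (stmt-QuantumFields-20520), organ WREG of LINE g18-2 `Cruxes/…/Lines/wreg_chart.lean` — (CB-0) CENTRAL-BOND ∕
# PLAQUETTE ∕ EMBEDDED-SITE LETTERS: one central crossing bond per plaquette; the endpoints of a central bond are never embedded sites

Cell `ym3-torus` (HUMAN RULING D-0037 — YM₃ on T³ is ladder rung R3, not the Clay problem), width seat `ym3-torus-px21` g9; count-neutral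
helper (`--kind proof --supports stmt-QuantumFields-20520 --as helper`).  Theorems only: 0 `def`, 0 `instance`, 0 `notation`, 0 `sorry`.

WHY.  The two remaining Haar-nullity stubs EDGE ∕ LEVEL-NEAR of LINE g18-2 (and their Theorems-side twins, seats px17 g6 ∕ w4-20520 g14) use a
ONE-SITE GAUGE MOVE at an embedded coarse endpoint `emb⁽ⁿ⁾(c₊)` to upgrade «a.e. datum» to «every datum», and read the plaquette variable of the
charted field through ONE pivot.  Both steps rest on elementary `ZMod` facts about Bałaban's centred block convention ([Balaban1987RG1] (0.1)–(0.4):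
`L` odd, coarse sites embedded as block CENTRES `n ↦ nL + (L−1)/2`, the central crossing bond `β(c) = ⟨emb c₋ + ((L−1)/2)e_μ, μ⟩`):
* §1 the source coordinates of `β(c)` (`centralBond_src_apply`, `centralBond_tgt_apply`) and the divisibility engine `false_of_emb_add_eq`
  (two embedded coordinates cannot differ by a non-zero integer of modulus `< L`);
* §2 ★ `centralBond_src_ne_emb`, ★ `centralBond_tgt_ne_emb`: NO endpoint of a central bond is an embedded site (`L ∤ (L−1)/2`, `L ∤ (L+1)/2`) — so a
  gauge transformation supported on embedded sites commutes with `update` at every central bond (`gaugeAct_update_comm` in §2, generic group);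
* §3 ★★ `centralBond_eq_of_mem_plaqBonds` ∕ ★★ `eq_of_centralBond_mem_plaqBonds`: TWO CENTRAL BONDS LYING ON ONE PLAQUETTE COINCIDE (twelve cases:
  parallel edges differ by one transverse unit, perpendicular pairs would force `L ∣ (L−1)/2` or `L ∣ (L+1)/2`) — ONE PIVOT PER PLAQUETTE.

All in the standing range `j + 1 ≤ m + K` (no wrap-around), generic `P : Params`; tools BY NAME from `BlockAveragingHaarAC`
(`lineSite_apply_int`, `L_dvd_of_emb_add_eq`, `eq_zero_of_L_dvd`, `centralBond_injective`) and `B14.Eq12InteriorLocality.plaqBonds`.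

HONEST SCOPE.  Lattice bookkeeping about the published formula (0.4); nothing of Bałaban's analysis asserted; EDGE ∕ LEVEL-NEAR ∕ CHARGE ∕ WREG ∕
S2β ∕ stmt-QuantumFields-20520 are NOT proved here; no summit statement is proved; rung R3 = YM₃ on T³ — NOT d = 4, NOT infinite volume, NOT a
mass gap, NOT Clay.
-/

namespace Summit.QuantumFields.YangMills.Theorems.WregCentralBondPlaquetteLetters

open Function
open Literature.MathematicalPhysics.QuantumFieldTheory.Balaban1983to89
open Literature.MathematicalPhysics.QuantumFieldTheory.Balaban1983to89.T4Continuum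
open Literature.MathematicalPhysics.QuantumFieldTheory.Balaban1983to89.AveragingRT
open Literature.MathematicalPhysics.QuantumFieldTheory.Balaban1983to89.BlockAveragingHaarAC
  (centralBond centralBond_injective lineSite_apply_int L_dvd_of_emb_add_eq eq_zero_of_L_dvd)
open Literature.MathematicalPhysics.QuantumFieldTheory.Balaban1983to89.B14.Eq12InteriorLocality (plaqBonds mem_plaqBonds)

variable {P : Params} {j : ℕ}

/-! ## §1  Coordinates of the central crossing bond and the divisibility engine -/

/-- The source of `β(c)` in coordinates: `emb c₋ + ((L−1)/2)·e_{dir c}`. [cite: Balaban1987RG1, (0.4) p.253 (bookkeeping)] -/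
theorem centralBond_src_apply (c : PBond P (j + 1)) (ν : Fin P.d) :
    (centralBond c).src ν =
      emb c.src ν + (((if ν = c.dir then ((((P.L - 1) / 2 : ℕ) : ℤ)) else 0 : ℤ)) : ZMod (P.sitesPerDir j)) := by
  show lineSite c ((P.L - 1) / 2) ν = _
  rw [lineSite_apply_int]

/-- The direction of `β(c)` is the direction of `c`. [cite: Balaban1987RG1, (0.4) p.253 (bookkeeping)] -/
theorem centralBond_dir (c : PBond P (j + 1)) : (centralBond c).dir = c.dir := rfl

/-- `(x + e_μ) μ = x μ + 1`. [folklore] -/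
theorem shift_apply_self (x : Site P j) (μ : Fin P.d) : x.shift μ μ = x μ + 1 := by
  simp [Site.shift]

/-- `(x + e_μ) ν = x ν` for `ν ≠ μ`. [folklore] -/
theorem shift_apply_of_ne (x : Site P j) {μ ν : Fin P.d} (h : ν ≠ μ) : x.shift μ ν = x ν := by
  simp [Site.shift, Function.update_of_ne h]

/-- The target of `β(c)` in coordinates: `emb c₋ + ((L−1)/2 + 1)·e_{dir c}` = `emb c₋ + ((L+1)/2)·e_{dir c}`. [cite: Balaban1987RG1, (0.4) p.253 (bookkeeping)] -/
theorem centralBond_tgt_apply (c : PBond P (j + 1)) (ν : Fin P.d) :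
    (centralBond c).tgt ν =
      emb c.src ν + (((if ν = c.dir then ((((P.L - 1) / 2 : ℕ) : ℤ)) + 1 else 0 : ℤ)) : ZMod (P.sitesPerDir j)) := by
  show ((centralBond c).src.shift (centralBond c).dir) ν = _
  rw [centralBond_dir]
  by_cases h : ν = c.dir
  · subst h
    rw [shift_apply_self, centralBond_src_apply, if_pos rfl, if_pos rfl]
    push_cast; ring
  · rw [shift_apply_of_ne _ h, centralBond_src_apply, if_neg h, if_neg h]

/-- ★ **THE DIVISIBILITY ENGINE**: two embedded coordinates cannot differ by a non-zero integer of modulus `< L` —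
`emb y ν + r = emb y′ ν + r′` with `r ≠ r′`, `|r′ − r| < L` is impossible in the standing range (`L_dvd_of_emb_add_eq` + `eq_zero_of_L_dvd`).
[cite: Balaban1987RG1, (0.1) p.251 (bookkeeping)] -/
theorem false_of_emb_add_eq (hj : j + 1 ≤ P.m + P.K) {y y' : Site P (j + 1)} {ν : Fin P.d} {r r' : ℤ}
    (h : emb y ν + (r : ZMod (P.sitesPerDir j)) = emb y' ν + (r' : ZMod (P.sitesPerDir j)))
    (h1 : -(P.L : ℤ) < r' - r) (h2 : r' - r < P.L) (hne : r ≠ r') : False := by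
  have hdvd := L_dvd_of_emb_add_eq hj h
  have h0 := eq_zero_of_L_dvd hdvd h1 h2
  exact hne (by omega)

/-! ## §2  The endpoints of a central bond are never embedded sites; gauge moves supported on embedded sites commute with `update` at central bonds -/

/-- ★ **THE SOURCE OF A CENTRAL BOND IS NOT AN EMBEDDED SITE**: `(β(c))₋ ≠ emb y` for every coarse `y` (longitudinal coordinate: `L ∤ (L−1)/2`,
as `1 ≤ (L−1)/2 < L` for odd `L ≥ 3`). [cite: Balaban1987RG1, (0.1) p.251 and (0.4) p.253 (bookkeeping)] -/
theorem centralBond_src_ne_emb (hj : j + 1 ≤ P.m + P.K) (c : PBond P (j + 1)) (y : Site P (j + 1)) :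
    (centralBond c).src ≠ emb y := by
  intro h
  have hL := two_mul_half_add_one P
  have hL1 := P.hL.2
  have hν := congrFun h c.dir
  rw [centralBond_src_apply, if_pos rfl] at hν
  have h' : emb c.src c.dir + (((((P.L - 1) / 2 : ℕ) : ℤ)) : ZMod (P.sitesPerDir j)) =
      emb y c.dir + ((0 : ℤ) : ZMod (P.sitesPerDir j)) := by
    rw [hν]; push_cast; ring
  exact false_of_emb_add_eq hj h' (by push_cast; omega) (by push_cast; omega) (by push_cast; omega)

/-- ★ **THE TARGET OF A CENTRAL BOND IS NOT AN EMBEDDED SITE**: `(β(c))₊ ≠ emb y` for every coarse `y` (longitudinal coordinate: `L ∤ (L+1)/2`,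
as `0 < (L+1)/2 < L` for `L ≥ 3`). [cite: Balaban1987RG1, (0.1) p.251 and (0.4) p.253 (bookkeeping)] -/
theorem centralBond_tgt_ne_emb (hj : j + 1 ≤ P.m + P.K) (c : PBond P (j + 1)) (y : Site P (j + 1)) :
    (centralBond c).tgt ≠ emb y := by
  intro h
  have hL := two_mul_half_add_one P
  have hL1 := P.hL.2
  have hν := congrFun h c.dir
  rw [centralBond_tgt_apply, if_pos rfl] at hν
  have h' : emb c.src c.dir + (((((P.L - 1) / 2 : ℕ) : ℤ) + 1 : ℤ) : ZMod (P.sitesPerDir j)) =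
      emb y c.dir + ((0 : ℤ) : ZMod (P.sitesPerDir j)) := by
    rw [hν]; push_cast; ring
  exact false_of_emb_add_eq hj h' (by push_cast; omega) (by push_cast; omega) (by push_cast; omega)

section Gauge

variable {G : Type*} [GaugeGroup G]

/-- A gauge transformation trivial at both endpoints of the bond `b` commutes with `update` at `b`:
`(U[b ↦ g])^u = U^u[b ↦ g]`. [cite: Balaban1985Averaging, (8) p.18 (bookkeeping)] -/
theorem gaugeAct_update_comm [DecidableEq (PBond P j)] (u : GaugeTransf P j G) (U : GaugeField P j G) (b : PBond P j) (g : G)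
    (hs : u b.src = 1) (ht : u b.tgt = 1) :
    GaugeField.gaugeAct u (update U b g) = update (GaugeField.gaugeAct u U) b g := by
  funext b'
  by_cases hb : b' = b
  · subst hb
    simp [GaugeField.gaugeAct, hs, ht]
  · simp [GaugeField.gaugeAct, update_of_ne hb]

/-- ★ **A GAUGE TRANSFORMATION SUPPORTED ON EMBEDDED SITES COMMUTES WITH `update` AT EVERY CENTRAL BOND** (`u x = 1` unless `x = emb y` for some
coarse `y`): the one-site gauge move of the EDGE ∕ LEVEL-NEAR upgrades does not see the pivots. [cite: Balaban1985Averaging, (8) p.18; Balaban1987RG1, (0.4) p.253 (bookkeeping)] -/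
theorem gaugeAct_update_centralBond_comm [DecidableEq (PBond P j)] (hj : j + 1 ≤ P.m + P.K) (u : GaugeTransf P j G)
    (hu : ∀ x : Site P j, (∀ y : Site P (j + 1), x ≠ emb y) → u x = 1) (U : GaugeField P j G) (c : PBond P (j + 1)) (g : G) :
    GaugeField.gaugeAct u (update U (centralBond c) g) = update (GaugeField.gaugeAct u U) (centralBond c) g :=
  gaugeAct_update_comm u U (centralBond c) g (hu _ (centralBond_src_ne_emb hj c)) (hu _ (centralBond_tgt_ne_emb hj c))

end Gauge

/-! ## §3  ONE PIVOT PER PLAQUETTE: two central bonds lying on one plaquette coincide -/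

/-- Coordinates of a plaquette edge that IS the central bond of `c`: if `β(c) = ⟨s, κ⟩` then `κ = dir c` and
`s ν = emb c₋ ν + ((L−1)/2)·[ν = κ]`. [cite: Balaban1987RG1, (0.4) p.253 (bookkeeping)] -/
theorem apply_eq_of_centralBond_eq {c : PBond P (j + 1)} {s : Site P j} {κ : Fin P.d} (h : centralBond c = ⟨s, κ⟩) (ν : Fin P.d) :
    c.dir = κ ∧ s ν = emb c.src ν + (((if ν = κ then ((((P.L - 1) / 2 : ℕ) : ℤ)) else 0 : ℤ)) : ZMod (P.sitesPerDir j)) := by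
  have hd : c.dir = κ := by rw [← centralBond_dir c, h]
  have hs : (centralBond c).src = s := by rw [h]
  refine ⟨hd, ?_⟩
  rw [← hs, centralBond_src_apply, hd]

/-- ★★ **TWO CENTRAL BONDS ON ONE PLAQUETTE ARE EQUAL.**  For a plaquette `p = ⟨x, x+e_μ, x+e_μ+e_ν, x+e_ν⟩` (`μ < ν`) and coarse bonds `c`, `c′`
with `β(c), β(c′) ∈ ∂p`: `β(c) = β(c′)`.  The two `μ`-edges have sources `x`, `x+e_ν` differing by ONE transverse unit (`L ∤ 1`); the two
`ν`-edges likewise; a `μ`-edge and a `ν`-edge through a common corner would force `L ∣ (L−1)/2` or `L ∣ (L+1)/2` in the `μ`-coordinate —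
impossible for odd `L ≥ 3`.  Standing range `j + 1 ≤ m + K`. [cite: Balaban1987RG1, (0.1) p.251 and (0.4) p.253 (bookkeeping)] -/
theorem centralBond_eq_of_mem_plaqBonds (hj : j + 1 ≤ P.m + P.K) {p : Plaq P j} {c c' : PBond P (j + 1)}
    (hc : centralBond c ∈ plaqBonds p) (hc' : centralBond c' ∈ plaqBonds p) : centralBond c = centralBond c' := by
  have hL := two_mul_half_add_one P
  have hL1 := P.hL.2
  have hμν : p.μ ≠ p.ν := ne_of_lt p.hμν
  have hνμ : p.ν ≠ p.μ := (ne_of_lt p.hμν).symm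
  -- the `μ`-coordinate of the sources of the four edges, and the `ν`-coordinate, read through `apply_eq_of_centralBond_eq`
  rw [mem_plaqBonds] at hc hc'
  -- abbreviation for the half block size `k = (L−1)/2` (opaque to `push_cast`)
  set k : ℕ := (P.L - 1) / 2 with hk
  have hk1 : 1 ≤ k := by omega
  have hkL : k + 1 < P.L := by omega
  rcases hc with h1 | h1 | h1 | h1 <;> rcases hc' with h2 | h2 | h2 | h2
  -- 16 cases; the four diagonal ones are `rfl` after rewriting, the twelve off-diagonal ones contradict the engine
  · rw [h1, h2]
  · -- β(c) = ⟨x, μ⟩, β(c') = ⟨x+e_μ, ν⟩ : μ-coordinate: x μ = emb c₋ μ + hh, x μ + 1 = emb c'₋ μ + 0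
    exfalso
    obtain ⟨hd1, e1⟩ := apply_eq_of_centralBond_eq h1 p.μ
    obtain ⟨hd2, e2⟩ := apply_eq_of_centralBond_eq h2 p.μ
    rw [if_pos rfl] at e1
    rw [if_neg hμν, shift_apply_self, e1] at e2
    have h' : emb c.src p.μ + (((k : ℤ) + 1 : ℤ) : ZMod (P.sitesPerDir j)) = emb c'.src p.μ + ((0 : ℤ) : ZMod (P.sitesPerDir j)) := by
      rw [← e2, ← hk]; push_cast; ring
    exact false_of_emb_add_eq hj h' (by omega) (by omega) (by omega)
  · -- β(c) = ⟨x, μ⟩, β(c') = ⟨x+e_ν, μ⟩ : ν-coordinate: x ν = emb c₋ ν + 0, x ν + 1 = emb c'₋ ν + 0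
    exfalso
    obtain ⟨hd1, e1⟩ := apply_eq_of_centralBond_eq h1 p.ν
    obtain ⟨hd2, e2⟩ := apply_eq_of_centralBond_eq h2 p.ν
    rw [if_neg hνμ] at e1
    rw [if_neg hνμ, shift_apply_self, e1] at e2
    have h' : emb c.src p.ν + ((0 + 1 : ℤ) : ZMod (P.sitesPerDir j)) = emb c'.src p.ν + ((0 : ℤ) : ZMod (P.sitesPerDir j)) := by
      rw [← e2]; push_cast; ring
    exact false_of_emb_add_eq hj h' (by omega) (by omega) (by omega)
  · -- β(c) = ⟨x, μ⟩, β(c') = ⟨x, ν⟩ : μ-coordinate: x μ = emb c₋ μ + hh = emb c'₋ μ + 0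
    exfalso
    obtain ⟨hd1, e1⟩ := apply_eq_of_centralBond_eq h1 p.μ
    obtain ⟨hd2, e2⟩ := apply_eq_of_centralBond_eq h2 p.μ
    rw [if_pos rfl] at e1
    rw [if_neg hμν, e1] at e2
    have h' : emb c.src p.μ + (((k : ℤ) : ℤ) : ZMod (P.sitesPerDir j)) = emb c'.src p.μ + ((0 : ℤ) : ZMod (P.sitesPerDir j)) := by
      rw [e2]
    exact false_of_emb_add_eq hj h' (by omega) (by omega) (by omega)
  · -- β(c) = ⟨x+e_μ, ν⟩, β(c') = ⟨x, μ⟩ (symmetric of case 2)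
    exfalso
    obtain ⟨hd1, e1⟩ := apply_eq_of_centralBond_eq h1 p.μ
    obtain ⟨hd2, e2⟩ := apply_eq_of_centralBond_eq h2 p.μ
    rw [if_pos rfl] at e2
    rw [if_neg hμν, shift_apply_self, e2] at e1
    have h' : emb c'.src p.μ + (((k : ℤ) + 1 : ℤ) : ZMod (P.sitesPerDir j)) = emb c.src p.μ + ((0 : ℤ) : ZMod (P.sitesPerDir j)) := by
      rw [← e1, ← hk]; push_cast; ring
    exact false_of_emb_add_eq hj h' (by omega) (by omega) (by omega)
  · rw [h1, h2]
  · -- β(c) = ⟨x+e_μ, ν⟩, β(c') = ⟨x+e_ν, μ⟩ : μ-coordinate: x μ + 1 = emb c₋ μ + 0, (x+e_ν) μ = x μ = emb c'₋ μ + hh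
    exfalso
    obtain ⟨hd1, e1⟩ := apply_eq_of_centralBond_eq h1 p.μ
    obtain ⟨hd2, e2⟩ := apply_eq_of_centralBond_eq h2 p.μ
    rw [if_neg hμν, shift_apply_self] at e1
    rw [if_pos rfl, shift_apply_of_ne _ hμν] at e2
    rw [e2] at e1
    have h' : emb c'.src p.μ + (((k : ℤ) + 1 : ℤ) : ZMod (P.sitesPerDir j)) = emb c.src p.μ + ((0 : ℤ) : ZMod (P.sitesPerDir j)) := by
      rw [← e1, ← hk]; push_cast; ring
    exact false_of_emb_add_eq hj h' (by omega) (by omega) (by omega)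
  · -- β(c) = ⟨x+e_μ, ν⟩, β(c') = ⟨x, ν⟩ : μ-coordinate: x μ + 1 = emb c₋ μ + 0, x μ = emb c'₋ μ + 0
    exfalso
    obtain ⟨hd1, e1⟩ := apply_eq_of_centralBond_eq h1 p.μ
    obtain ⟨hd2, e2⟩ := apply_eq_of_centralBond_eq h2 p.μ
    rw [if_neg hμν, shift_apply_self] at e1
    rw [if_neg hμν] at e2
    rw [e2] at e1
    have h' : emb c'.src p.μ + ((0 + 1 : ℤ) : ZMod (P.sitesPerDir j)) = emb c.src p.μ + ((0 : ℤ) : ZMod (P.sitesPerDir j)) := by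
      rw [← e1]; push_cast; ring
    exact false_of_emb_add_eq hj h' (by omega) (by omega) (by omega)
  · -- β(c) = ⟨x+e_ν, μ⟩, β(c') = ⟨x, μ⟩ (symmetric of case 3)
    exfalso
    obtain ⟨hd1, e1⟩ := apply_eq_of_centralBond_eq h1 p.ν
    obtain ⟨hd2, e2⟩ := apply_eq_of_centralBond_eq h2 p.ν
    rw [if_neg hνμ] at e2
    rw [if_neg hνμ, shift_apply_self, e2] at e1
    have h' : emb c'.src p.ν + ((0 + 1 : ℤ) : ZMod (P.sitesPerDir j)) = emb c.src p.ν + ((0 : ℤ) : ZMod (P.sitesPerDir j)) := by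
      rw [← e1]; push_cast; ring
    exact false_of_emb_add_eq hj h' (by omega) (by omega) (by omega)
  · -- β(c) = ⟨x+e_ν, μ⟩, β(c') = ⟨x+e_μ, ν⟩ (symmetric of case 7)
    exfalso
    obtain ⟨hd1, e1⟩ := apply_eq_of_centralBond_eq h1 p.μ
    obtain ⟨hd2, e2⟩ := apply_eq_of_centralBond_eq h2 p.μ
    rw [if_pos rfl, shift_apply_of_ne _ hμν] at e1
    rw [if_neg hμν, shift_apply_self] at e2
    rw [e1] at e2
    have h' : emb c.src p.μ + (((k : ℤ) + 1 : ℤ) : ZMod (P.sitesPerDir j)) = emb c'.src p.μ + ((0 : ℤ) : ZMod (P.sitesPerDir j)) := by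
      rw [← e2, ← hk]; push_cast; ring
    exact false_of_emb_add_eq hj h' (by omega) (by omega) (by omega)
  · rw [h1, h2]
  · -- β(c) = ⟨x+e_ν, μ⟩, β(c') = ⟨x, ν⟩ : μ-coordinate: (x+e_ν) μ = x μ = emb c₋ μ + hh, x μ = emb c'₋ μ + 0
    exfalso
    obtain ⟨hd1, e1⟩ := apply_eq_of_centralBond_eq h1 p.μ
    obtain ⟨hd2, e2⟩ := apply_eq_of_centralBond_eq h2 p.μ
    rw [if_pos rfl, shift_apply_of_ne _ hμν] at e1
    rw [if_neg hμν] at e2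
    rw [e1] at e2
    have h' : emb c.src p.μ + (((k : ℤ) : ℤ) : ZMod (P.sitesPerDir j)) = emb c'.src p.μ + ((0 : ℤ) : ZMod (P.sitesPerDir j)) := by
      rw [e2]
    exact false_of_emb_add_eq hj h' (by omega) (by omega) (by omega)
  · -- β(c) = ⟨x, ν⟩, β(c') = ⟨x, μ⟩ (symmetric of case 4)
    exfalso
    obtain ⟨hd1, e1⟩ := apply_eq_of_centralBond_eq h1 p.μ
    obtain ⟨hd2, e2⟩ := apply_eq_of_centralBond_eq h2 p.μ
    rw [if_neg hμν] at e1
    rw [if_pos rfl, e1] at e2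
    have h' : emb c'.src p.μ + (((k : ℤ) : ℤ) : ZMod (P.sitesPerDir j)) = emb c.src p.μ + ((0 : ℤ) : ZMod (P.sitesPerDir j)) := by
      rw [e2]
    exact false_of_emb_add_eq hj h' (by omega) (by omega) (by omega)
  · -- β(c) = ⟨x, ν⟩, β(c') = ⟨x+e_μ, ν⟩ (symmetric of case 8)
    exfalso
    obtain ⟨hd1, e1⟩ := apply_eq_of_centralBond_eq h1 p.μ
    obtain ⟨hd2, e2⟩ := apply_eq_of_centralBond_eq h2 p.μ
    rw [if_neg hμν] at e1
    rw [if_neg hμν, shift_apply_self, e1] at e2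
    have h' : emb c.src p.μ + ((0 + 1 : ℤ) : ZMod (P.sitesPerDir j)) = emb c'.src p.μ + ((0 : ℤ) : ZMod (P.sitesPerDir j)) := by
      rw [← e2]; push_cast; ring
    exact false_of_emb_add_eq hj h' (by omega) (by omega) (by omega)
  · -- β(c) = ⟨x, ν⟩, β(c') = ⟨x+e_ν, μ⟩ (symmetric of case 12)
    exfalso
    obtain ⟨hd1, e1⟩ := apply_eq_of_centralBond_eq h1 p.μ
    obtain ⟨hd2, e2⟩ := apply_eq_of_centralBond_eq h2 p.μ
    rw [if_neg hμν] at e1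
    rw [if_pos rfl, shift_apply_of_ne _ hμν, e1] at e2
    have h' : emb c'.src p.μ + (((k : ℤ) : ℤ) : ZMod (P.sitesPerDir j)) = emb c.src p.μ + ((0 : ℤ) : ZMod (P.sitesPerDir j)) := by
      rw [e2]
    exact false_of_emb_add_eq hj h' (by omega) (by omega) (by omega)
  · rw [h1, h2]

/-- ★★ **ONE PIVOT PER PLAQUETTE**: if the central bonds of `c` and `c′` both lie on `∂p`, then `c = c′` (`centralBond_eq_of_mem_plaqBonds` +
`centralBond_injective`). [cite: Balaban1987RG1, (0.1) p.251 and (0.4) p.253 (bookkeeping)] -/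
theorem eq_of_centralBond_mem_plaqBonds (hj : j + 1 ≤ P.m + P.K) {p : Plaq P j} {c c' : PBond P (j + 1)}
    (hc : centralBond c ∈ plaqBonds p) (hc' : centralBond c' ∈ plaqBonds p) : c = c' :=
  centralBond_injective hj (centralBond_eq_of_mem_plaqBonds hj hc hc')

/-- **AT MOST ONE EDGE OF A PLAQUETTE IS A CENTRAL BOND** (set form): the edges of `∂p` that are central bonds of some coarse bond form a
subsingleton. [cite: Balaban1987RG1, (0.4) p.253 (bookkeeping)] -/
theorem subsingleton_plaqBonds_inter_range_centralBond (hj : j + 1 ≤ P.m + P.K) (p : Plaq P j) :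
    (plaqBonds p ∩ Set.range (centralBond : PBond P (j + 1) → PBond P j)).Subsingleton := by
  rintro b ⟨hb, c, rfl⟩ b' ⟨hb', c', rfl⟩
  exact centralBond_eq_of_mem_plaqBonds hj hb hb'

end Summit.QuantumFields.YangMills.Theorems.WregCentralBondPlaquetteLetters
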